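import Summits.NavierStokesRegularity.NavierStokesRegularity.Theses.SelfMixingDichotomy
import Summits.NavierStokesRegularity.NavierStokesRegularity.Theorems.SelfMixingDichotomySequentialTypeIExclusionStructure
import Summits.NavierStokesRegularity.NavierStokesRegularity.Theorems.SelfMixingDichotomySequentialTypeIExclusionQuantPayoffReduction
import Summits.NavierStokesRegularity.NavierStokesRegularity.Theorems.SelfMixingDichotomyLocalToGlobal

/-!
# Crux `SelfMixingDichotomy.SequentialTypeIExclusion` (stmt-NavierStokesRegularity-1424), line `registered`:
  the restated route closes the summit modulo NAMED statements only (helper file, `--supports`)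

`navierStokesRegularity_of_quantMixingPayoff`:

  **NavierStokesRegularity ⇐ P_quant ∧ CoherentScaleExclusion ∧ ¬TypeISingularityExists**,

where P_quant is the quantitative finite-depth form of the route's payoff crux `MixingPayoff` (see
`…SequentialTypeIExclusionQuantPayoffReduction.lean`: below a bounded-Reynolds scale, a K(M)-band whose
high-Reynolds members all δ-mix contains another bounded-Reynolds scale), `CoherentScaleExclusion` is the
route's crux S2 AS FILED, and `TypeISingularityExists` is the registered conjecture decl (centred Type-I
exclusion, Seregin's open question). Composition: `bdd_of_quantMixingPayoff` (P_quant ∧ S2 ∧ sup-form of S1 ⇒ local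
boundedness at every final-time point), `supForm_of_not_typeISingularityExists` (sup-form ⇐ ¬TISE, all glue landed),
the closed support item `LocalToGlobal` (`selfMixingDichotomy_localToGlobal_proof`) and the closed shared item
`NoBlowupToClay` (`NoBlowupToClay_holds`).

Compared with the route's deciding theorem `Theses.SelfMixingDichotomy.closes` (P, S2, S1, LocalToGlobal,
NoBlowupToClay), the liminf-form crux S1 — whose extra content over Type-I exclusion is the unnamed open mechanism
"no scale-intermittency" (registered stub `stub_windowsForceTypeI`) — is no longer needed: its burden is carried by
making the payoff quantitative. This is the lead's evidence for RESTATING the route rather than promoting the stub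
to a new crux.
-/

noncomputable section

-- the summit and its single problem share the name (D-0017 nested layout)
set_option linter.dupNamespace false

namespace Summit.NavierStokesRegularity.NavierStokesRegularity.Theorems.SequentialTypeIExclusion.Registered

open scoped ENNReal NNReal Topology
open Literature.Analysis.FluidPDE Set Filter MeasureTheory Function Metric

/-- **The summit from the restated route: NavierStokesRegularity ⇐ P_quant ∧ S2 ∧ ¬TypeISingularityExists.**
P_quant + S2 + the sup-form of S1 give local boundedness at every final-time point of every ν = 1 classical
Leray–Hopf solution from a rapidly decaying datum (`bdd_of_quantMixingPayoff`); the sup-form follows from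
`¬ TypeISingularityExists` (`supForm_of_not_typeISingularityExists`); `LocalToGlobal` (proved) turns local
boundedness into `NoBlowup` for every viscosity and `NoBlowupToClay` (proved) into the Clay statement. -/
theorem navierStokesRegularity_of_quantMixingPayoff : (∃ δ : ℝ, 0 < δ ∧ ∀ M : ℝ, ∃ K : ℝ, 2 ≤ K ∧ ∀ T : ℝ, 0 < T → ∀ (u : ℝ → EuclideanSpace ℝ (Fin 3) → EuclideanSpace ℝ (Fin 3)) (p : ℝ → EuclideanSpace ℝ (Fin 3) → ℝ), Literature.Analysis.FluidPDE.IsClassicalNSSolutionOn (Set.Ico 0 T) 1 0 u p → Literature.Analysis.FluidPDE.IsLerayHopfOn T 1 0 (u 0) u → Literature.Analysis.FluidPDE.HasRapidSpatialDecay (u 0) → ∀ x₀ : EuclideanSpace ℝ (Fin 3), ∀ r : ℝ, 0 < r → r ^ 2 ≤ T → Literature.Analysis.FluidPDE.cknC r ((T, x₀) : ℝ × EuclideanSpace ℝ (Fin 3)) u ≤ ENNReal.ofReal M → (∀ ρ ∈ Set.Ico (r / K) r, ENNReal.ofReal M ≤ Literature.Analysis.FluidPDE.cknC ρ ((T, x₀)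 : ℝ × EuclideanSpace ℝ (Fin 3)) u → (∀ θ : ℝ → EuclideanSpace ℝ (Fin 3) → ℝ, Literature.Analysis.FluidPDE.IsSmoothSpaceTimeOn (Set.Icc (T - ρ ^ 2) (T - ρ ^ 2 / 2)) θ → Literature.Analysis.FluidPDE.HasUniformRapidDecayOn (Set.Icc (T - ρ ^ 2) (T - ρ ^ 2 / 2)) θ → (∀ t ∈ (Set.Icc (T - ρ ^ 2) (T - ρ ^ 2 / 2)), ∀ x : EuclideanSpace ℝ (Fin 3), Literature.Analysis.FluidPDE.timeDerivWithin (Set.Icc (T - ρ ^ 2) (T - ρ ^ 2 / 2)) θ t x + inner ℝ (u t x) (gradient (θ t) x) = Laplacian.laplacian (θ t) x) → Function.support (θ (T - ρ ^ 2)) ⊆ Metric.ball x₀ ρ → ∫ x, (θ (T - ρ ^ 2 / 2) x) ^ 2 ≤ δ ^ 2 * ∫ x, (θ (T - ρ ^ 2) x) ^ 2)) → ∃ ρ ∈ Set.Icc (r / K) (r / 2), Literature.Analysis.FluidPDE.cknC ρ ((T, x₀) : ℝ × EuclideanSpace ℝ (Fin 3)) u ≤ ENNReal.ofReal M) → Summit.NavierStokesRegularity.NavierStokesRegularity.Theses.SelfMixingDichotomy.CoherentScaleExclusion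 → ¬ Literature.Analysis.FluidPDE.TypeISingularityExists → _root_.NavierStokesRegularity :=
  fun hP hS2 hno =>
    Theses.SelfMixingDichotomy.NoBlowupToClay_holds
      (Summit.NavierStokesRegularity.NavierStokesRegularity.Theorems.selfMixingDichotomy_localToGlobal_proof
        (bdd_of_quantMixingPayoff hP hS2 (supForm_of_not_typeISingularityExists hno)))

end Summit.NavierStokesRegularity.NavierStokesRegularity.Theorems.SequentialTypeIExclusion.Registered

end
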